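import Summits.Langlands.Langlands.Theses.SteinbergWeightVelocity
import Literature.NumberTheory.GaloisRepresentations.FramedRepTwist

/-!
# The KPX package `IsKPX` is invariant under reindexing `Drig`
(negative knowledge for crux stmt-Langlands-13450 `WeightVelocity`, route SteinbergWeightVelocity;
it bites every item of the route quantifying `∀ 𝔇, IsKPX → …`: 13449, 13451–13455)

The interface `PhiGammaModuleRobba` + `IsKPX d` records about `ρ ↦ D_rig(ρ)` only: triviality of
`H_F`, functoriality in the frame, full faithfulness and essential surjectivity on classes, `Drig 1`
trivial, rank one lands in SOME `𝓡(δ)`, continuity/étaleness.  These properties are stable under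
precomposition with ANY self-map `Φ` of framed Galois representations that is a conj-equivariant
bijection on conjugacy classes fixing `1` (`Reindexing`); hence `reindex 𝓣 Φ` (`Drig := Drig ∘ Φ`,
all other fields unchanged) is again a datum with `IsKPX d` (`isKPX_reindex`).  A non-trivial
admissible `Φ` exists for every continuous character `μ : Γ_F → Eˣ`: `Reindexing.twistSwap μ`, the
twist `ρ ↦ ρ ⊗ μ` corrected on the two central points `1`, `μ⁻¹·1` (`twistSwap_apply`).

Consequence for the crux (`parameter_rigidity_of_weightVelocity`): clause (i) of `WeightVelocity`
fixes the permutation `σ` and the constant characters `η` BEFORE quantifying over all KPX families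
`𝔇`; applied to `𝔇` and to the reindexed family it forces ONE `ℚ̄_p`-valued parameter `P` both for
a model of `ρ|_{Γ_{K_v}}` and (`hasParameterAt_reindex_iff`) for a reindexed model `Φ rE` — e.g.
`rE ⊗ μ`, whose parameters in the genuine theory are those of `rE` multiplied by `μ ∘ Art_{K_v}`.
For Steinberg-type `ρ|_{K_v}` (unique triangulation) this is false on paper: the crux is
refuted-misstated, repair = a normalisation predicate on `𝔇` (rank-one Artin normalisation
`Drig η ≅ 𝓡(η ∘ Art)`, twist compatibility, exactness of `Drig`), each violated by `twistSwap μ`.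
Not Lean-closable as `¬ WeightVelocity` (needs a `CuspidalAutomorphicRepData` witness, `n ≥ 2`).
[folklore]
-/

namespace Summit.Langlands.Langlands.Theorems.WeightVelocityNegative

open Literature.NumberTheory.GaloisRepresentations Field

universe u v w

noncomputable section

section Swap

variable {F : Type u} [Field F] {E : Type v} [Field E] [TopologicalSpace E]

namespace Reindexing

open Classical in
/-- The transposition of two points of `FramedGaloisRep F E n` (used with both points fixed by
every change of frame). [folklore] -/
def swapPt {n : ℕ} (c x : FramedGaloisRep F E n) : FramedGaloisRep F E n :=
  if x = 1 then c else if x = c then 1 else x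

/-- `swapPt c 1 = c`. [folklore] -/
theorem swapPt_one {n : ℕ} (c : FramedGaloisRep F E n) : swapPt c 1 = c := by
  simp [swapPt]

/-- `swapPt c c = 1`. [folklore] -/
theorem swapPt_self {n : ℕ} (c : FramedGaloisRep F E n) : swapPt c c = 1 := by
  by_cases hc : c = 1 <;> simp [swapPt, hc]

/-- `swapPt c` fixes every other point. [folklore] -/
theorem swapPt_of_ne {n : ℕ} {c x : FramedGaloisRep F E n} (h1 : x ≠ 1) (hc : x ≠ c) :
    swapPt c x = x := by
  simp [swapPt, h1, hc]

/-- `swapPt c` is an involution. [folklore] -/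
theorem swapPt_swapPt {n : ℕ} (c x : FramedGaloisRep F E n) : swapPt c (swapPt c x) = x := by
  by_cases h1 : x = 1
  · subst h1; rw [swapPt_one, swapPt_self]
  by_cases hc : x = c
  · subst hc; rw [swapPt_self, swapPt_one]
  rw [swapPt_of_ne h1 hc, swapPt_of_ne h1 hc]

end Reindexing

end Swap

section Reindexing

variable {F : Type u} [Field F] {E : Type v} [Field E] [TopologicalSpace E] [IsTopologicalRing E]

/-- Conjugating by `1` does nothing. [folklore] -/
theorem conj_by_one {n : ℕ} (ρ : FramedGaloisRep F E n) : FramedRep.conj 1 ρ = ρ := by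
  refine ContinuousMonoidHom.ext fun σ => ?_
  rw [FramedRep.conj_apply, inv_one, one_mul, mul_one]

/-- Conjugating the trivial framed representation does nothing. [folklore] -/
theorem conj_one_rep {n : ℕ} (g : GL (Fin n) E) :
    FramedRep.conj g (1 : FramedGaloisRep F E n) = 1 := by
  refine ContinuousMonoidHom.ext fun σ => ?_
  rw [FramedRep.conj_apply, ContinuousMonoidHom.coe_one, Pi.one_apply, mul_one, mul_inv_cancel]

/-- `g⁻¹ (g ρ g⁻¹) g = ρ`. [folklore] -/
theorem conj_inv_conj {n : ℕ} (g : GL (Fin n) E) (ρ : FramedGaloisRep F E n) :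
    FramedRep.conj g⁻¹ (FramedRep.conj g ρ) = ρ := by
  refine ContinuousMonoidHom.ext fun σ => ?_
  simp only [FramedRep.conj_apply, inv_inv]
  group

/-- Twisting by a fixed character is injective. [folklore] -/
theorem twist_injective {n : ℕ} (μ : absoluteGaloisGroup F →ₜ* Eˣ) {ρ ρ' : FramedGaloisRep F E n}
    (h : ρ.twist μ = ρ'.twist μ) : ρ = ρ' := by
  rw [← FramedRep.twist_twist_inv ρ μ, h, FramedRep.twist_twist_inv]

/-- `(ρ ⊗ μ⁻¹) ⊗ μ = ρ`. [folklore] -/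
theorem twist_inv_twist {n : ℕ} (ρ : FramedGaloisRep F E n) (μ : absoluteGaloisGroup F →ₜ* Eˣ) :
    (ρ.twist μ⁻¹).twist μ = ρ := by
  rw [FramedRep.twist_twist, mul_inv_cancel, FramedRep.twist_one]

variable (F E) in
/-- An **admissible reindexing** of framed `p`-adic Galois representations of `Γ_F` over `E`:
a self-map `Φ` of `FramedGaloisRep F E n` for every `n` which (a) is equivariant for changes of
frame up to a change of frame, (b) is injective and (c) surjective on conjugacy classes, and
(d) fixes the trivial representation.  These are EXACTLY the properties of `ρ ↦ D_rig(ρ)` that the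
axioms of `PhiGammaModuleData` / `PhiGammaModuleRobba.IsKPX` record, so `Drig ∘ Φ` satisfies them
again (`reindexData`, `isKPX_reindex`). [folklore] -/
structure Reindexing where
  /-- The self-map, rank by rank. -/
  Φ : ∀ {n : ℕ}, FramedGaloisRep F E n → FramedGaloisRep F E n
  /-- Equivariance up to a change of frame. -/
  conj : ∀ {n : ℕ} (g : GL (Fin n) E) (ρ : FramedGaloisRep F E n),
    ∃ g' : GL (Fin n) E, Φ (FramedRep.conj g ρ) = FramedRep.conj g' (Φ ρ)
  /-- Injectivity on conjugacy classes. -/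
  inj : ∀ {n : ℕ} (ρ ρ' : FramedGaloisRep F E n) (g : GL (Fin n) E),
    Φ ρ' = FramedRep.conj g (Φ ρ) → ∃ g' : GL (Fin n) E, ρ' = FramedRep.conj g' ρ
  /-- Surjectivity on conjugacy classes. -/
  surj : ∀ {n : ℕ} (ρ₀ : FramedGaloisRep F E n),
    ∃ (ρ : FramedGaloisRep F E n) (g : GL (Fin n) E), Φ ρ = FramedRep.conj g ρ₀
  /-- The trivial representation is fixed. -/
  one : ∀ n : ℕ, Φ (1 : FramedGaloisRep F E n) = 1

namespace Reindexing

variable (F E) in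
/-- The identity reindexing. [folklore] -/
protected def id : Reindexing F E where
  Φ := fun ρ => ρ
  conj := fun g _ => ⟨g, rfl⟩
  inj := fun _ _ g h => ⟨g, h⟩
  surj := fun ρ₀ => ⟨ρ₀, 1, (conj_by_one ρ₀).symm⟩
  one := fun _ => rfl

/-- `swapPt c` commutes with changes of frame when `c` is fixed by them. [folklore] -/
theorem swapPt_conj {n : ℕ} {c : FramedGaloisRep F E n} (hcen : ∀ g : GL (Fin n) E, FramedRep.conj g c = c)
    (g : GL (Fin n) E) (x : FramedGaloisRep F E n) :
    swapPt c (FramedRep.conj g x) = FramedRep.conj g (swapPt c x) := by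
  by_cases h1 : x = 1
  · subst h1; rw [conj_one_rep, swapPt_one, hcen]
  by_cases hc : x = c
  · subst hc; rw [hcen, swapPt_self, conj_one_rep]
  have h1' : FramedRep.conj g x ≠ 1 := fun h => h1 (by
    rw [← conj_inv_conj g x, h, conj_one_rep])
  have hc' : FramedRep.conj g x ≠ c := fun h => hc (by
    rw [← conj_inv_conj g x, h, hcen])
  rw [swapPt_of_ne h1' hc', swapPt_of_ne h1 hc]

/-- The scalar representation `μ · 1` is fixed by every change of frame. [folklore] -/
theorem conj_one_twist {n : ℕ} (μ : absoluteGaloisGroup F →ₜ* Eˣ) (g : GL (Fin n) E) :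
    FramedRep.conj g ((1 : FramedGaloisRep F E n).twist μ) = (1 : FramedGaloisRep F E n).twist μ := by
  rw [FramedRep.conj_twist, conj_one_rep]

/-- **The twist-swap reindexing** attached to a continuous character `μ : Γ_F → Eˣ`:
`ρ ↦ ρ ⊗ μ`, corrected by the transposition of the two central points `1` and `μ·1` so that the
trivial representation stays fixed.  On every `ρ ∉ {1, μ⁻¹·1}` it IS the twist `ρ ⊗ μ`
(`twistSwap_apply`). [folklore] -/
def twistSwap (μ : absoluteGaloisGroup F →ₜ* Eˣ) : Reindexing F E where
  Φ := fun ρ => swapPt ((1 : FramedGaloisRep F E _).twist μ) (ρ.twist μ)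
  conj := fun g ρ => ⟨g, by
    rw [← FramedRep.conj_twist, swapPt_conj (conj_one_twist μ)]⟩
  inj := fun ρ ρ' g h => ⟨g, by
    have h' := congrArg (swapPt ((1 : FramedGaloisRep F E _).twist μ)) h
    rw [swapPt_swapPt, ← swapPt_conj (conj_one_twist μ), swapPt_swapPt,
      FramedRep.conj_twist] at h'
    exact twist_injective μ h'⟩
  surj := fun ρ₀ => ⟨(swapPt ((1 : FramedGaloisRep F E _).twist μ) ρ₀).twist μ⁻¹, 1, by
    rw [twist_inv_twist, swapPt_swapPt, conj_by_one]⟩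
  one := fun n => by
    show swapPt ((1 : FramedGaloisRep F E n).twist μ) ((1 : FramedGaloisRep F E n).twist μ) = 1
    exact swapPt_self _

/-- Off the two exceptional points `1` and `μ⁻¹ · 1`, `twistSwap μ` is the twist by `μ`.
[folklore] -/
theorem twistSwap_apply {n : ℕ} (μ : absoluteGaloisGroup F →ₜ* Eˣ) {ρ : FramedGaloisRep F E n}
    (h1 : ρ ≠ 1) (hμ : ρ ≠ (1 : FramedGaloisRep F E n).twist μ⁻¹) :
    (twistSwap μ).Φ ρ = ρ.twist μ := by
  show swapPt ((1 : FramedGaloisRep F E n).twist μ) (ρ.twist μ) = ρ.twist μ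
  refine swapPt_of_ne (fun h => hμ ?_) (fun h => h1 (twist_injective μ h))
  rw [← FramedRep.twist_twist_inv ρ μ, h]

end Reindexing

/-! ### Reindexed `(φ, Γ)`-module data -/

variable {p : ℕ} [Fact p.Prime] [TopologicalSpace F]

/-- **Reindexing the `D_rig` of a `(φ, Γ_F)`-module datum**: same ring, same rank-one objects,
`Drig := Drig ∘ Φ`.  All axioms of `PhiGammaModuleData` are preserved. [folklore] -/
def reindexData (𝔇 : PhiGammaModuleData.{u, v, w} p F E) (Φ : Reindexing F E) :
    PhiGammaModuleData.{u, v, w} p F E where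
  ring := 𝔇.ring
  smul_eq_self := 𝔇.smul_eq_self
  Drig := fun ρ => 𝔇.Drig (Φ.Φ ρ)
  Drig_matGamma_eq_one := fun ρ σ h => 𝔇.Drig_matGamma_eq_one (Φ.Φ ρ) σ h
  Drig_conj := fun g ρ => by
    obtain ⟨g', hg'⟩ := Φ.conj g ρ
    show (𝔇.Drig (Φ.Φ ρ)).IsIso (𝔇.Drig (Φ.Φ (FramedRep.conj g ρ)))
    rw [hg']
    exact 𝔇.Drig_conj g' (Φ.Φ ρ)
  Drig_injective := fun ρ ρ' h => by
    obtain ⟨g, hg⟩ := 𝔇.Drig_injective (Φ.Φ ρ) (Φ.Φ ρ') h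
    exact Φ.inj ρ ρ' g hg
  Drig_one := fun n => by
    show (𝔇.Drig (Φ.Φ 1)).IsIso _
    rw [Φ.one]
    exact 𝔇.Drig_one n
  charMod := 𝔇.charMod
  charMod_matGamma_eq_one := 𝔇.charMod_matGamma_eq_one
  charMod_one := 𝔇.charMod_one
  charMod_injective := 𝔇.charMod_injective
  Drig_rank_one := fun η => 𝔇.Drig_rank_one (Φ.Φ η)

/-- Reindexing keeps the ring. [folklore] -/
@[simp] theorem reindexData_ring (𝔇 : PhiGammaModuleData.{u, v, w} p F E) (Φ : Reindexing F E) :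
    (reindexData 𝔇 Φ).ring = 𝔇.ring := rfl

/-- Reindexing replaces `Drig` by `Drig ∘ Φ`. [folklore] -/
@[simp] theorem reindexData_Drig (𝔇 : PhiGammaModuleData.{u, v, w} p F E) (Φ : Reindexing F E)
    {n : ℕ} (ρ : FramedGaloisRep F E n) : (reindexData 𝔇 Φ).Drig ρ = 𝔇.Drig (Φ.Φ ρ) := rfl

/-- Reindexing keeps the rank-one objects. [folklore] -/
@[simp] theorem reindexData_charMod (𝔇 : PhiGammaModuleData.{u, v, w} p F E) (Φ : Reindexing F E)
    (δ : Fˣ →ₜ* Eˣ) : (reindexData 𝔇 Φ).charMod δ = 𝔇.charMod δ := rfl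

/-- **Triangulinity is transported**: `ρ` is trianguline with parameter `δ` for the reindexed
datum iff `Φ ρ` is for the original one. [folklore] -/
theorem isTriangulineWith_reindexData_iff (𝔇 : PhiGammaModuleData.{u, v, w} p F E)
    (Φ : Reindexing F E) {n : ℕ} (ρ : FramedGaloisRep F E n) (δ : Fin n → (Fˣ →ₜ* Eˣ)) :
    ρ.IsTriangulineWith (reindexData 𝔇 Φ) δ ↔ (Φ.Φ ρ).IsTriangulineWith 𝔇 δ :=
  Iff.rfl

/-- **Reindexing the enriched datum** (`PhiGammaModuleRobba`): only `Drig` changes. [folklore] -/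
def reindex (𝓣 : PhiGammaModuleRobba.{u, v, w} p F E) (Φ : Reindexing F E) :
    PhiGammaModuleRobba.{u, v, w} p F E where
  toPhiGammaModuleData := reindexData 𝓣.toPhiGammaModuleData Φ
  topR := 𝓣.topR
  topRingR := 𝓣.topRingR
  continuous_frob := 𝓣.continuous_frob
  continuous_act := 𝓣.continuous_act
  continuous_orbit := 𝓣.continuous_orbit
  gen := 𝓣.gen
  dense_gen := 𝓣.dense_gen
  homToH1 := 𝓣.homToH1
  IsEtale := 𝓣.IsEtale

/-- The underlying datum of the reindexed enriched datum. [folklore] -/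
@[simp] theorem reindex_toPhiGammaModuleData (𝓣 : PhiGammaModuleRobba.{u, v, w} p F E)
    (Φ : Reindexing F E) :
    (reindex 𝓣 Φ).toPhiGammaModuleData = reindexData 𝓣.toPhiGammaModuleData Φ := rfl

/-- `Drig` of the reindexed enriched datum. [folklore] -/
@[simp] theorem reindex_Drig (𝓣 : PhiGammaModuleRobba.{u, v, w} p F E) (Φ : Reindexing F E)
    {n : ℕ} (ρ : FramedGaloisRep F E n) : (reindex 𝓣 Φ).Drig ρ = 𝓣.Drig (Φ.Φ ρ) := rfl

/-- **(R2) The KPX package does not see the reindexing**: `IsKPX d` for `𝓣` implies `IsKPX d`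
for `reindex 𝓣 Φ`, for EVERY admissible reindexing `Φ` (e.g. `twistSwap μ`).  So `IsKPX`
does not pin `Drig` down in any rank `≥ 2` (in rank one only up to `Drig_rank_one`'s
unnamed `δ`). [folklore] -/
theorem isKPX_reindex {𝓣 : PhiGammaModuleRobba.{u, v, w} p F E} {d : ℕ} (h : 𝓣.IsKPX d)
    (Φ : Reindexing F E) : (reindex 𝓣 Φ).IsKPX d := by
  obtain ⟨hL, hR, hC, hCFT, hE1, hE2, hE3⟩ := h
  refine ⟨hL, hR, hC, hCFT, fun n ρ => hE1 n (Φ.Φ ρ), hE2, fun n D hcyc hcont het => ?_⟩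
  obtain ⟨ρ₀, hρ₀⟩ := hE3 n D hcyc hcont het
  obtain ⟨ρ, g, hg⟩ := Φ.surj ρ₀
  refine ⟨ρ, ?_⟩
  show (𝓣.Drig (Φ.Φ ρ)).IsIso D
  rw [hg]
  exact (𝓣.Drig_conj g ρ₀).symm.trans hρ₀

end Reindexing

/-! ### (R2) Consequence for the crux: parameter rigidity under every admissible reindexing -/

section Crux

open Summit.Langlands.Langlands.Theses.SteinbergWeightVelocity
open Literature.NumberTheory.Automorphic IsDedekindDomain NumberField

/-- Unfolding: a parameter at `v` for the REINDEXED family is a model `rE` of `ρ|_{Γ_{K_v}}` whose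
image `Φ rE` under the reindexing (e.g. `rE ⊗ μ`) is trianguline with that parameter in the
ORIGINAL theory. [folklore] -/
theorem hasParameterAt_reindex_iff {K : Type} [Field K] [NumberField K] {p : ℕ} [Fact p.Prime]
    {n : ℕ} (v : HeightOneSpectrum (𝓞 K))
    (𝔇 : ∀ (E₀ : IntermediateField ℚ_[p] (PadicAlgCl p)), FiniteDimensional ℚ_[p] E₀ →
      PhiGammaModuleRobba.{0, 0, 0} p (v.adicCompletion K) E₀)
    (Φ : ∀ (E₀ : IntermediateField ℚ_[p] (PadicAlgCl p)), FiniteDimensional ℚ_[p] E₀ →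
      Reindexing (v.adicCompletion K) E₀)
    (ρ : FramedGaloisRep K (PadicAlgCl p) n)
    (P : Fin n → ((v.adicCompletion K)ˣ →ₜ* (PadicAlgCl p)ˣ)) :
    ρ.HasParameterAt v (fun E₀ hE₀ => (reindex (𝔇 E₀ hE₀) (Φ E₀ hE₀)).toPhiGammaModuleData) P ↔
      ∃ (E₀ : IntermediateField ℚ_[p] (PadicAlgCl p)) (hE₀ : FiniteDimensional ℚ_[p] E₀)
        (rE : FramedGaloisRep (v.adicCompletion K) E₀ n)
        (δE : Fin n → ((v.adicCompletion K)ˣ →ₜ* E₀ˣ)),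
        HasQlModel (ρ.toLocal v) E₀ rE ∧
          ((Φ E₀ hE₀).Φ rE).IsTriangulineWith (𝔇 E₀ hE₀).toPhiGammaModuleData δE ∧
            ∀ (i : Fin n) (x : (v.adicCompletion K)ˣ),
              ((P i x : (PadicAlgCl p)ˣ) : PadicAlgCl p) = algebraMap E₀ (PadicAlgCl p) (δE i x : E₀ˣ) :=
  Iff.rfl

/-- **(R2) Parameter rigidity forced by `WeightVelocity`.**  In the setting of the crux, for every
KPX family `𝔇` and EVERY family `Φ` of admissible reindexings, clause (i) at the point `x` (applied
to `𝔇` and to the reindexed family, which is again KPX by `isKPX_reindex`) yields a representative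
`ρx` of `ρ` and ONE parameter `P = (δ_x · η) ∘ σ` such that both `ρx` and — through
`hasParameterAt_reindex_iff` — the reindexed models `Φ rE` (e.g. `rE ⊗ μ` for `twistSwap μ`) are
trianguline with the SAME `ℚ̄_p`-valued parameter `P`.  On paper this is false at the route's
own points: `ρ|_{K_v}` of Steinberg type has a unique triangulation, and the parameters of
`rE ⊗ μ` are those of `rE` multiplied by `μ ∘ Art` (`μ ≠ 1` quadratic, so `E₀`-valued for every
`E₀`).  Classification: refuted-misstated; repair C′₂ = a normalisation predicate on `𝔇`
(rank-one Artin normalisation, twist compatibility, exactness of `Drig`). [folklore] -/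
theorem parameter_rigidity_of_weightVelocity (h : WeightVelocity) (K : Type) [Field K]
    [NumberField K] [IsCMField K] (n : ℕ) (hcpt : isCompact_glFiniteIntegralLevel n K)
    (π : CuspidalAutomorphicRepData n K hcpt) (hn : 2 ≤ n) (hRA : π.1.IsRegularAlgebraic)
    (p : ℕ) [Fact p.Prime] (ι : PadicAlgCl p ≃+* ℂ) (ρ : FramedGaloisRep K (PadicAlgCl p) n)
    (hss : ρ.toGaloisRep.IsSemisimple)
    (hcompat : ∀ᶠ w : HeightOneSpectrum (𝓞 K) in Filter.cofinite, ∀ α : Multiset ℂ,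
      π.1.HasSatakeParamAt w α →
        ρ.IsUnramifiedAt w ∧ ρ.HasFrobCharpolyAt w (arithFrobPolyOfSatake ι w.residueCard n α))
    (v : HeightOneSpectrum (𝓞 K)) (hv : ((p : ℕ) : 𝓞 K) ∈ v.asIdeal)
    (hsec : 3 ≤ n ∨ 2 * (v.asIdeal.ramificationIdx ℤ * v.asIdeal.inertiaDeg ℤ) ≤ Module.finrank ℚ K)
    (hSt : ∀ (L : LocalLanglandsDatum (v.adicCompletion K))
      (πv : SmoothIrrep (Matrix.GeneralLinearGroup (Fin n) (v.adicCompletion K))),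
      π.1.HasLocalComponentAt v πv.ρ → ((L.recGL n (IrrClass.mk πv)).out.1).N ^ (n - 1) ≠ 0)
    (𝔇 : ∀ (E₀ : IntermediateField ℚ_[p] (PadicAlgCl p)), FiniteDimensional ℚ_[p] E₀ →
      PhiGammaModuleRobba.{0, 0, 0} p (v.adicCompletion K) E₀)
    (h𝔇 : ∀ (E₀ : IntermediateField ℚ_[p] (PadicAlgCl p)) (hE₀ : FiniteDimensional ℚ_[p] E₀),
      (𝔇 E₀ hE₀).IsKPX (v.asIdeal.ramificationIdx ℤ * v.asIdeal.inertiaDeg ℤ))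
    (Φ : ∀ (E₀ : IntermediateField ℚ_[p] (PadicAlgCl p)), FiniteDimensional ℚ_[p] E₀ →
      Reindexing (v.adicCompletion K) E₀) :
    ∃ (ρx : FramedGaloisRep K (PadicAlgCl p) n)
      (P : Fin n → ((v.adicCompletion K)ˣ →ₜ* (PadicAlgCl p)ˣ)),
      (∃ g : GL (Fin n) (PadicAlgCl p), FramedRep.conj g ρx = ρ) ∧
        ρx.HasParameterAt v (fun E₀ hE₀ => (𝔇 E₀ hE₀).toPhiGammaModuleData) P ∧
          ρx.HasParameterAt v
            (fun E₀ hE₀ => (reindex (𝔇 E₀ hE₀) (Φ E₀ hE₀)).toPhiGammaModuleData) P := by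
  obtain ⟨S, Ev, x, χ, σ, η, Z, -, -, hconj, -, hxZ, hi, -⟩ :=
    h K n hcpt π hn hRA p ι ρ hss hcompat v hv hsec hSt
  exact ⟨Ev.galoisRep x, fun j => Ev.param x ⟨v, hv⟩ (σ j) * η j, hconj, hi 𝔇 h𝔇 x hxZ,
    hi (fun E₀ hE₀ => reindex (𝔇 E₀ hE₀) (Φ E₀ hE₀)) (fun E₀ hE₀ => isKPX_reindex (h𝔇 E₀ hE₀) _)
      x hxZ⟩

end Crux

end

end Summit.Langlands.Langlands.Theorems.WeightVelocityNegative
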